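import Summits.QuantumFields.BalabanUV.Beta.MultiscaleParametrixTorus

/-!
# Beta / MultiscaleParametrixTorusFlat — NODE (w4-c′) AT `U = 1` WITH THE COERCIVITY DISCHARGED: the level-free parametrix of
# `Δ + Σ_l a_lG_lᵀG_l` on the torus with NO operator-side hypothesis beyond the data (MODEL)

`MultiscaleParametrixTorus.parametrix_torus_adapted` takes a cell-sum coercivity `C > 0` as a hypothesis; at `U = 1` (bond
matrices and block transports `= 1`) gen-7's (D) `MultiscaleCoerciveTorus.multiscale_coercive_torus_flat` supplies it with
`C = min(c_min²/(4d), a_min/2)` from print-size weights from below (`a_min/S² ≤ a_lω_l²S_l^d`) and `0 < c_min ≤ |c|`.  This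
module is that one-step composition: **`parametrix_torus_adapted_flat`** — for the operator of (D) on a pairwise-disjoint
COVERING cube family carrying the level weights, a scale-adapted box family (bumps `h_z` with `Σ_z h_z² = 1`, hulls `χ_z` =
unions of cells carrying `supp h_z` and its bond-neighbourhood, box scale `n_z`, hull scale `≤ L·n_z`, `|c∂h_z| ≤ c_maxC₁/(Mn_z)`,
`|Δ_c h_z| ≤ c_max²C₂/(Mn_z)²`, averaging-oscillation budget `≤ 2a_maxC₃/(Mn_z²)`, at most `ν` hulls through a site) and
`ν·C_rem < M` with `C_rem = remConst d c_max a_max (min(c_min²/(4d), a_min/2)) L C₁ C₂ C₃`: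
`1 − R′` is a unit, `A⁻¹ = G′₀(1 − R′)⁻¹`, `‖(1 − R′)⁻¹‖_{ℓ²} ≤ (1 − C_remν/M)⁻¹` — the Thm 3.7 / (2.38)-SHAPE resolvent whose
threshold sees `d, c_min, c_max, a_min, a_max, L, C₁, C₂, C₃, ν` ONLY (unit `b2b-balaban-beta-d4-p2`, GEN 9, MODEL crew; O.2
skeleton v1.5.0 §8.10).

HONEST FRAMING: discharging `BetaPertH` makes Bałaban's UV stability UNCONDITIONAL — NOT the continuum limit, NOT the
Clay problem.  HONEST DEPENDENCY (verbatim): «continuum YM on T⁴ ⇐ BetaPertH ∧ nine spine estimates (0/9 proved);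
BetaPertH ⇐ (D1) ∧ (D4) ∧ CAP+tail; G-an2-4 gates asym, D1 and NE2/3/4.»  THIS MODULE DISCHARGES NOTHING of `BetaPertH`,
asserts NOTHING printed and cites nothing as a fact (ABSOLUTE RULE): [folklore] composition of two MODEL theorems of this
lineage; the box family is DATA ((w4-a′) open).  LOCI (shape only): [B9] = `Balaban1985BackgroundPropagators` (3.87)–(3.90)
pp. 408–409, Thm 3.7, (3.24) p. 394; [B6] = `Balaban1984PropagatorsII` (2.36)–(2.40) pp. 229–230.  No class change on row D4
(critical-path width 0; D4 DISCHARGE NO DATE); NOT BetaPertH, NOT continuum, NOT Clay, NOT summit progress.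
-/

namespace Summit.QuantumFields.BalabanUV.Beta.MultiscaleParametrixTorusFlat

open Finset Function
open Summit.QuantumFields.BalabanUV.Beta.BoxPoincare (Box)
open Summit.QuantumFields.BalabanUV.Beta.MultiscaleCoerciveTorus
open Summit.QuantumFields.BalabanUV.Beta.MultiscaleDecayBudget
open Literature.MathematicalPhysics.QuantumFieldTheory.Balaban1983to89
open B9Thm37Sum B9Thm37Glue B9Thm37GlueTorusInv
open Literature.MathematicalPhysics.QuantumFieldTheory.Balaban1983to89.B9Thm37GluePU (bsrc btgt)
open Literature.MathematicalPhysics.QuantumFieldTheory.Balaban1983to89.B9Thm37GlueTorusCov (tblk)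
open Literature.MathematicalPhysics.QuantumFieldTheory.Balaban1983to89.B9Thm37GlueTorusCovLevels (levelOp levelSum)
open B5TorusCover (UT Ctr ctrU)
open Summit.QuantumFields.BalabanUV.Beta.CovariantTowerL2
open Summit.QuantumFields.BalabanUV.Beta.MultiscaleRemainderLeibniz
open Summit.QuantumFields.BalabanUV.Beta.MultiscaleParametrix
open Summit.QuantumFields.BalabanUV.Beta.MultiscaleParametrixTorus

noncomputable section

variable {d : ℕ} {N : Fin d → ℕ} [∀ i, NeZero (N i)] [NeZero d] {Cp J K : Type} [Fintype Cp] [DecidableEq Cp] [Fintype J]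
  [Fintype K] (S : J → ℕ) (hS : ∀ l, 1 ≤ S l) (hdivS : ∀ l i, S l ∣ N i) (lvl : K → J) (zc : (k : K) → Ctr N (S (lvl k)))
  (a : J → ℝ) (ω : J → UT N → ℝ) (c : UT N × Fin d → ℝ)

/-- **THE LEVEL-FREE PARAMETRIX AT `U = 1`, COERCIVITY DISCHARGED (MODEL; node (w4-c′) ∘ (D)).**  The operator of
`multiscale_coercive_torus_flat` (`Δ + Σ_l a_lG_lᵀG_l`, plain block sums, bond matrices and transports `= 1`) on a pairwise-disjoint
COVERING cube family carrying the level weights with print-size weights on both sides (`a_min/S² ≤ a_lω_l²S_l^d`, `|ω_l| ≤ ω̄_l`),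
`0 < c_min ≤ |c|`, and a scale-adapted box family as in `parametrix_torus_adapted` with `ν·C_rem < M`,
`C_rem = remConst d c_max a_max (min(c_min²/(4d), a_min/2)) L C₁ C₂ C₃`:
**`1 − R′` is a unit, `A⁻¹ = G′₀(1 − R′)⁻¹`, `‖(1 − R′)⁻¹‖_{ℓ²} ≤ (1 − C_remν/M)⁻¹`** — nothing depends on the box scales, the
levels, their number or the volume. [cite: Balaban1985BackgroundPropagators, (3.87)–(3.90) pp.408–409 + Thm 3.7 + (3.24) p.394; Balaban1984PropagatorsII, (2.36)–(2.38) p.229] -/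
theorem parametrix_torus_adapted_flat {ι : Type} [Fintype ι]
    (hdisj : ∀ k k' v v', cellPt S hS hdivS lvl zc k v = cellPt S hS hdivS lvl zc k' v' → k = k')
    (hcover : ∀ x : UT N, ∃ k, ∃ v : Box d (S (lvl k)), cellPt S hS hdivS lvl zc k v = x) (ha : ∀ j, 0 ≤ a j)
    (hsupp : ∀ l x, ω l (ctrU N (S l) (tblk (hS l) (hdivS l) x)) ≠ 0 → ∃ k v, lvl k = l ∧ cellPt S hS hdivS lvl zc k v = x)
    {wmax : J → ℝ} (hw0 : ∀ l, 0 ≤ wmax l) (hw : ∀ l x, |ω l (ctrU N (S l) (tblk (hS l) (hdivS l) x))| ≤ wmax l)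
    {amin : ℝ} (hamin : 0 < amin)
    (hscale_lo : ∀ k, amin / (S (lvl k) : ℝ) ^ 2 ≤ a (lvl k) * ω (lvl k) (ctrU N (S (lvl k)) (zc k)) ^ 2 * (S (lvl k) : ℝ) ^ d)
    {cmin cmax : ℝ} (hcmin : 0 < cmin) (hc_lo : ∀ b, cmin ≤ |c b|) (hcmax : 0 ≤ cmax)
    {M L amax C₁ C₂ C₃ : ℝ} (hM : 1 ≤ M) (hL : 1 ≤ L) (hamax : 0 ≤ amax) (hC₁ : 0 ≤ C₁) (hC₂ : 0 ≤ C₂) (hC₃ : 0 ≤ C₃)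
    (hs : ι → UT N → ℝ) (hsq : ∀ x, ∑ z, hs z x ^ 2 = 1) (hh : ∀ z x, |hs z x| ≤ 1)
    (χ : ι → UT N → ℝ) (hχ : ∀ z x, χ z x = 0 ∨ χ z x = 1)
    (hχcell : ∀ z k v, χ z (cellPt S hS hdivS lvl zc k v) = χ z (ctrU N (S (lvl k)) (zc k)))
    (hsite : ∀ z x, hs z x ≠ 0 → χ z x = 1)
    (hbond : ∀ z b, (hs z (bsrc b) ≠ 0 ∨ hs z (btgt b) ≠ 0) → χ z (bsrc b) = 1 ∧ χ z (btgt b) = 1)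
    (nz nH : ι → ℕ) (hnz : ∀ z, 1 ≤ nz z) (hnH : ∀ z, 1 ≤ nH z) (hHL : ∀ z, (nH z : ℝ) ≤ L * nz z)
    (hH : ∀ z x, χ z x = 1 → siteScale S hS hdivS lvl zc hcover x ≤ nH z)
    (hdh : ∀ z b, |c b * (hs z (btgt b) - hs z (bsrc b))| ≤ cmax * C₁ / (M * nz z))
    (hlap : ∀ z x, |lapH bsrc btgt c (hs z) x| ≤ cmax ^ 2 * C₂ / (M * nz z) ^ 2) (m : ι → J → ℝ) (hm : ∀ z l, 0 ≤ m z l)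
    (hosc : ∀ z l x, ω l (ctrU N (S l) (tblk (hS l) (hdivS l) x)) ≠ 0 →
      |hs z x - hs z (ctrU N (S l) (tblk (hS l) (hdivS l) x))| ≤ m z l)
    (hmsum : ∀ z, ∑ l, |a l| * (2 * (wmax l ^ 2 * ((S l ^ d : ℕ) : ℝ)) * m z l) ≤ 2 * amax * C₃ / (M * (nz z : ℝ) ^ 2))
    {ν : ℝ} (hν0 : 0 ≤ ν) (hν : ∀ x, ∑ z, χ z x ≤ ν)
    (hsmall : remConst d cmax amax (min (cmin ^ 2 / (4 * d)) (amin / 2)) L C₁ C₂ C₃ / M * ν < 1) :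
    IsUnit (1 - Rsum bsrc btgt c (fun _ => (oneM : Cp → Cp → ℝ))
        (levelSum (fun l x => ctrU N (S l) (tblk (hS l) (hdivS l) x)) (fun l x => ω l (ctrU N (S l) (tblk (hS l) (hdivS l) x)))
          (fun _ _ => (oneM : Cp → Cp → ℝ)) a)
        (levelOp bsrc btgt c (fun _ => (oneM : Cp → Cp → ℝ)) (fun l x => ctrU N (S l) (tblk (hS l) (hdivS l) x))
          (fun l x => ω l (ctrU N (S l) (tblk (hS l) (hdivS l) x))) (fun _ _ => (oneM : Cp → Cp → ℝ)) a) hs χ) ∧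
      Ring.inverse (levelOp bsrc btgt c (fun _ => (oneM : Cp → Cp → ℝ)) (fun l x => ctrU N (S l) (tblk (hS l) (hdivS l) x))
          (fun l x => ω l (ctrU N (S l) (tblk (hS l) (hdivS l) x))) (fun _ _ => (oneM : Cp → Cp → ℝ)) a) =
        G0sum (levelOp bsrc btgt c (fun _ => (oneM : Cp → Cp → ℝ)) (fun l x => ctrU N (S l) (tblk (hS l) (hdivS l) x))
          (fun l x => ω l (ctrU N (S l) (tblk (hS l) (hdivS l) x))) (fun _ _ => (oneM : Cp → Cp → ℝ)) a) hs χ *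
        Ring.inverse (1 - Rsum bsrc btgt c (fun _ => (oneM : Cp → Cp → ℝ))
          (levelSum (fun l x => ctrU N (S l) (tblk (hS l) (hdivS l) x)) (fun l x => ω l (ctrU N (S l) (tblk (hS l) (hdivS l) x)))
            (fun _ _ => (oneM : Cp → Cp → ℝ)) a)
          (levelOp bsrc btgt c (fun _ => (oneM : Cp → Cp → ℝ)) (fun l x => ctrU N (S l) (tblk (hS l) (hdivS l) x))
            (fun l x => ω l (ctrU N (S l) (tblk (hS l) (hdivS l) x))) (fun _ _ => (oneM : Cp → Cp → ℝ)) a) hs χ) ∧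
      L2Bound (Ring.inverse (1 - Rsum bsrc btgt c (fun _ => (oneM : Cp → Cp → ℝ))
          (levelSum (fun l x => ctrU N (S l) (tblk (hS l) (hdivS l) x)) (fun l x => ω l (ctrU N (S l) (tblk (hS l) (hdivS l) x)))
            (fun _ _ => (oneM : Cp → Cp → ℝ)) a)
          (levelOp bsrc btgt c (fun _ => (oneM : Cp → Cp → ℝ)) (fun l x => ctrU N (S l) (tblk (hS l) (hdivS l) x))
            (fun l x => ω l (ctrU N (S l) (tblk (hS l) (hdivS l) x))) (fun _ _ => (oneM : Cp → Cp → ℝ)) a) hs χ))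
        (1 - remConst d cmax amax (min (cmin ^ 2 / (4 * d)) (amin / 2)) L C₁ C₂ C₃ / M * ν)⁻¹ := by
  have hd : 1 ≤ d := Nat.one_le_iff_ne_zero.mpr (NeZero.ne d)
  have hdpos : (0 : ℝ) < d := by exact_mod_cast hd
  have hC : 0 < min (cmin ^ 2 / (4 * d)) (amin / 2) := lt_min (by positivity) (by linarith)
  exact parametrix_torus_adapted S hS hdivS lvl zc (fun _ => oneM) (fun _ _ => oneM) a ω c hdisj hcover
    (fun _ i j => oneM_orth i j) (fun _ _ i i' => oneM_orth i i') ha hsupp hw0 hw hcmax hC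
    (fun f => multiscale_coercive_torus_flat hd S hS hdivS a ha ω c hcmin hc_lo lvl zc hdisj hamin.le hscale_lo f)
    hM hL hamax hC₁ hC₂ hC₃ hs hsq hh χ hχ hχcell hsite hbond nz nH hnz hnH hHL hH hdh hlap m hm hosc hmsum hν0 hν hsmall

end

end Summit.QuantumFields.BalabanUV.Beta.MultiscaleParametrixTorusFlat
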